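import Summits.FinalStateConjecture.FinalStateConjecture.Theorems.BulkKerrCaptureC2.Negative.BlockForm
import Summits.FinalStateConjecture.FinalStateConjecture.Theorems.PhaseMixingCaptureBulkKerrCaptureC2OfClaimByName
import Literature.Geometry.Lorentzian.KerrStabilitySubextremalCauchy
import HarnessLib

/-!
# STRATEGY CENSUS sketch — crux `BulkKerrCaptureC2` (stmt-FinalStateConjecture-14985)

Crux-strategist (wall-breaker, unit `cstrat-stmt-FinalStateConjecture-14985-p1`), 2026-08-17.
Companion to `Cruxes/BulkKerrCaptureC2/STRATEGY-CENSUS.md`: the typed objects of the four lens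
attempts, kernel-checked. NOTHING here is filed as an item or a line; see the census for why.

* §1 Strengthen — `S⁺₁ = HintzSubextremalClaim` (all orders, all leaves, local uniformity) and
  `S⁺₂ = StrongCaptureTwo` (pre-ruling strong form at `k = 2`), each `⇒` crux by LANDED theorems.
* §2 Decomposition — (a) spin split `SmallSpinC2 → AnnulusSpinC2 → crux`; (b) clause split
  `OrbitalAsymptoticC2 → ScriCompleteNearKerr → crux` (and the converse: an exact `↔`); (d) import
  split `HintzSubextremalClaim → ClaimPortC2 → crux` with `ClaimPortC2` PROVED (p99464).
  Every glue is proved below; no leaf is session-provable (census §Decomposition).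
-/

-- the doubled `FinalStateConjecture.FinalStateConjecture` path component trips dupNamespace
set_option linter.dupNamespace false

noncomputable section

open Set Filter Topology Function
open scoped Manifold ContDiff ENNReal Topology
open Literature.Geometry.Lorentzian
open Summit.FinalStateConjecture.FinalStateConjecture.Theses.PhaseMixingCapture (BulkKerrCaptureC2)
open Summit.FinalStateConjecture.FinalStateConjecture.Theorems
open Summit.FinalStateConjecture.FinalStateConjecture.Theorems.BulkKerrCapture.Negative (CaptureAt)
open Summit.FinalStateConjecture.FinalStateConjecture.Theorems.BulkKerrCaptureC2.Negative

namespace Summit.FinalStateConjecture.FinalStateConjecture.Cruxes.BulkKerrCaptureC2.StrategyCensus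

/-! ## §1 Strengthen -/

/-- `S⁺₁`: the vendored all-orders Hintz claim BY NAME (every normalised centre `χ₀`, every leaf
`ρ₀`, every order `k`, local uniformity in the spin). Strictly stronger than the crux (crux `↔` its
`(ρ₀, k) = (1, 2)` germ, p106217). [cite: Hintz2026, Thm. 13.1 (pp. 318–319)] -/
def HintzSubextremalClaim : Prop :=
  ∀ [Kerr.Facts] [Kerr.SliceFacts], hintz_kerr_stability_subextremal_cauchy_allOrders

/-- `S⁺₁ ⇒ crux` — LANDED (p99464, `bulkKerrCaptureC2_of_allOrdersClaim'`). [folklore] -/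
theorem bulkKerrCaptureC2_of_hintzSubextremalClaim (h : HintzSubextremalClaim) :
    BulkKerrCaptureC2 :=
  bulkKerrCaptureC2_of_allOrdersClaim' h

/-- `S⁺₂ = StrongCaptureTwo`: the pre-ruling strong form of bulk capture with the order pinned to
`k = 2` — bare finite-order `H^s_δ`-ball (no b-conormal side condition), Lipschitz–Hölder modulus
`C √dist`, one `(ε, C)` on `|a| ≤ a₁ M`. The residual of both round-2 lines (triage r2-2,
`TriageStrongForm.lean`). [folklore] -/
def StrongCaptureTwo : Prop :=
  ∀ [Kerr.Facts] [Kerr.SliceFacts], ∀ a₁ : ℝ, a₁ < 1 → ∃ (s : ℕ) (δ : ℝ),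
    ∀ (M : ℝ) (hM : 0 < M), ∃ ε > (0 : ℝ), ∃ C : ℝ, ∀ a : ℝ, |a| ≤ a₁ * M →
      CaptureAt s δ 2 M hM.le ε C a

/-- `S⁺₂ ⇒ crux` — LANDED (`PhaseMixingCaptureCaptureSuffices.bulkKerrCaptureC2_of_captureAt_two`).
[folklore] -/
theorem bulkKerrCaptureC2_of_strongCaptureTwo (h : StrongCaptureTwo) : BulkKerrCaptureC2 :=
  PhaseMixingCaptureCaptureSuffices.bulkKerrCaptureC2_of_captureAt_two h

/-! ## §2(a) Decomposition by spin range (provenance split: refereed small spins / claimed annulus) -/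

/-- `SmallSpinC2`: `C²`-capture on SOME small spin range `|a| ≤ a₀ M`, `a₀ > 0` — the
Klainerman–Szeftel/GKS/Shen regime, in the crux's block form. [cite: KlainermanSzeftel2023, Thm. 1.2.1] -/
def SmallSpinC2 : Prop :=
  ∀ [Kerr.Facts] [Kerr.SliceFacts], ∃ a₀ > (0 : ℝ), ∃ (s : ℕ) (δ : ℝ),
    ∀ (M : ℝ) (hM : 0 < M), ∀ η > (0 : ℝ), ∃ ε > (0 : ℝ), ∀ a : ℝ, |a| ≤ a₀ * M →
      CaptureC2At s δ M hM.le ε η a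

/-- `AnnulusSpinC2`: `C²`-capture on every spin annulus `a₀ M ≤ |a| ≤ a₁ M`, `0 < a₀`, `a₁ < 1`
(spins bounded away from `0` and from `M`) — the part only Hintz 2026 claims. [cite: Hintz2026, Thm. 13.1 (pp. 318–319)] -/
def AnnulusSpinC2 : Prop :=
  ∀ [Kerr.Facts] [Kerr.SliceFacts], ∀ a₀ a₁ : ℝ, 0 < a₀ → a₁ < 1 → ∃ (s : ℕ) (δ : ℝ),
    ∀ (M : ℝ) (hM : 0 < M), ∀ η > (0 : ℝ), ∃ ε > (0 : ℝ), ∀ a : ℝ, a₀ * M ≤ |a| →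
      |a| ≤ a₁ * M → CaptureC2At s δ M hM.le ε η a

/-- **Glue of the spin split**: `SmallSpinC2 → AnnulusSpinC2 → BulkKerrCaptureC2` (exponents merged
by `CaptureC2At.mono`, basins by `min`, spins by cases). [folklore] -/
theorem bulkKerrCaptureC2_of_spinSplit (hS : SmallSpinC2) (hA : AnnulusSpinC2) :
    BulkKerrCaptureC2 := by
  rw [bulkKerrCaptureC2_iff_captureC2At]
  intro _ _ a₁ ha₁
  obtain ⟨a₀, ha₀, s₁, δ₁, h₁⟩ := hS
  obtain ⟨s₂, δ₂, h₂⟩ := hA a₀ a₁ ha₀ ha₁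
  refine ⟨max s₁ s₂, max δ₁ δ₂, fun M hM η hη ↦ ?_⟩
  obtain ⟨ε₁, hε₁, h₁'⟩ := h₁ M hM η hη
  obtain ⟨ε₂, hε₂, h₂'⟩ := h₂ M hM η hη
  refine ⟨min ε₁ ε₂, lt_min hε₁ hε₂, fun a ha ↦ ?_⟩
  rcases le_or_gt |a| (a₀ * M) with hle | hgt
  · exact (h₁' a hle).mono (le_max_left _ _) (le_max_left _ _) (min_le_left _ _) le_rfl
  · exact (h₂' a hgt.le ha).mono (le_max_right _ _) (le_max_right _ _) (min_le_right _ _) le_rfl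

/-- Converse: the crux implies both spin pieces (so the split is exact). [folklore] -/
theorem spinSplit_of_bulkKerrCaptureC2 (h : BulkKerrCaptureC2) : SmallSpinC2 ∧ AnnulusSpinC2 := by
  rw [bulkKerrCaptureC2_iff_captureC2At] at h
  refine ⟨fun {_ _} ↦ ⟨1 / 2, by norm_num, h (1 / 2) (by norm_num)⟩, fun {_ _} a₀ a₁ _ ha₁ ↦ ?_⟩
  obtain ⟨s, δ, hsδ⟩ := h a₁ ha₁
  refine ⟨s, δ, fun M hM η hη ↦ ?_⟩
  obtain ⟨ε, hε, hcap⟩ := hsδ M hM η hη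
  exact ⟨ε, hε, fun a _ ha ↦ hcap a ha⟩

/-! ## §2(b) Decomposition by conclusion clause (asymptotic capture / completeness of far `𝓘⁺`) -/

/-- Block of `OrbitalAsymptoticC2`: the crux's conclusion WITHOUT the far-`𝓘⁺` clause. [folklore] -/
def OrbitalC2At [Kerr.Facts] [Kerr.SliceFacts] (s : ℕ) (δ : ℝ) (M : ℝ) (hM : 0 ≤ M)
    (ε η a : ℝ) : Prop :=
  ∀ (D : InitialDataSet 𝓘(ℝ, E3) (Kerr.slice a M)) [D.metric.HasLeviCivita],
    D.IsVacuumConstraintSolution →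
    (∀ s' : ℕ, InitialDataSet.dataWeightedSobolevEDist s' δ D (Kerr.data M a M hM) < ⊤) →
    InitialDataSet.dataWeightedSobolevEDist s δ D (Kerr.data M a M hM) < ENNReal.ofReal ε →
    ∀ 𝒟 : VacuumCauchyDevelopment D, 𝒟.IsMaximal →
      ∃ (M' a' : ℝ) (𝒟oc : Set 𝒟.carrier), Kerr.IsSubextremal M' a' ∧
        𝒟.toSpacetime.ConvergesToKerr 𝒟oc M' a' 2 ∧ |M' - M| + |a' - a| ≤ η

/-- Block of `ScriCompleteNearKerr`: ONLY the far-`𝓘⁺` clause (no tolerance `η`). [folklore] -/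
def ScriFarAt [Kerr.Facts] [Kerr.SliceFacts] (s : ℕ) (δ : ℝ) (M : ℝ) (hM : 0 ≤ M)
    (ε a : ℝ) : Prop :=
  ∀ (D : InitialDataSet 𝓘(ℝ, E3) (Kerr.slice a M)) [D.metric.HasLeviCivita],
    D.IsVacuumConstraintSolution →
    (∀ s' : ℕ, InitialDataSet.dataWeightedSobolevEDist s' δ D (Kerr.data M a M hM) < ⊤) →
    InitialDataSet.dataWeightedSobolevEDist s δ D (Kerr.data M a M hM) < ENNReal.ofReal ε →
    ∀ 𝒟 : VacuumCauchyDevelopment D, 𝒟.IsMaximal → 𝒟.HasCompleteFutureNullInfinityFar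

theorem OrbitalC2At.mono [Kerr.Facts] [Kerr.SliceFacts] {s s' : ℕ} {δ δ' : ℝ} {M : ℝ}
    {hM : 0 ≤ M} {ε ε' η η' a : ℝ} (h : OrbitalC2At s δ M hM ε η a) (hs : s ≤ s') (hδ : δ ≤ δ')
    (hε : ε' ≤ ε) (hη : η ≤ η') : OrbitalC2At s' δ' M hM ε' η' a := by
  intro D _ hvac hcon hdist 𝒟 hmax
  have hcon' : ∀ s'' : ℕ,
      InitialDataSet.dataWeightedSobolevEDist s'' δ D (Kerr.data M a M hM) < ⊤ := fun s'' ↦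
    lt_of_le_of_lt
      (NearExtremalKappaCapture.Negative.dataWeightedSobolevEDist_mono le_rfl hδ D _) (hcon s'')
  have hdist' : InitialDataSet.dataWeightedSobolevEDist s δ D (Kerr.data M a M hM) <
      ENNReal.ofReal ε :=
    lt_of_le_of_lt (NearExtremalKappaCapture.Negative.dataWeightedSobolevEDist_mono hs hδ D _)
      (hdist.trans_le (ENNReal.ofReal_le_ofReal hε))
  obtain ⟨M', a', 𝒟oc, hsub, hconv, hpar⟩ := h D hvac hcon' hdist' 𝒟 hmax
  exact ⟨M', a', 𝒟oc, hsub, hconv, hpar.trans hη⟩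

theorem ScriFarAt.mono [Kerr.Facts] [Kerr.SliceFacts] {s s' : ℕ} {δ δ' : ℝ} {M : ℝ}
    {hM : 0 ≤ M} {ε ε' a : ℝ} (h : ScriFarAt s δ M hM ε a) (hs : s ≤ s') (hδ : δ ≤ δ')
    (hε : ε' ≤ ε) : ScriFarAt s' δ' M hM ε' a := by
  intro D _ hvac hcon hdist 𝒟 hmax
  have hcon' : ∀ s'' : ℕ,
      InitialDataSet.dataWeightedSobolevEDist s'' δ D (Kerr.data M a M hM) < ⊤ := fun s'' ↦
    lt_of_le_of_lt
      (NearExtremalKappaCapture.Negative.dataWeightedSobolevEDist_mono le_rfl hδ D _) (hcon s'')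
  have hdist' : InitialDataSet.dataWeightedSobolevEDist s δ D (Kerr.data M a M hM) <
      ENNReal.ofReal ε :=
    lt_of_le_of_lt (NearExtremalKappaCapture.Negative.dataWeightedSobolevEDist_mono hs hδ D _)
      (hdist.trans_le (ENNReal.ofReal_le_ofReal hε))
  exact @h D _ hvac hcon' hdist' 𝒟 hmax

/-- `OrbitalAsymptoticC2`: the crux minus completeness of far `𝓘⁺` — `C²`-asymptotic stability
with `η`-close sub-extremal final parameters (still the nonlinear core). [cite: Hintz2026, Thm. 13.1 (pp. 318–319)] -/
def OrbitalAsymptoticC2 : Prop :=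
  ∀ [Kerr.Facts] [Kerr.SliceFacts], ∀ a₁ : ℝ, a₁ < 1 → ∃ (s : ℕ) (δ : ℝ),
    ∀ (M : ℝ) (hM : 0 < M), ∀ η > (0 : ℝ), ∃ ε > (0 : ℝ), ∀ a : ℝ, |a| ≤ a₁ * M →
      OrbitalC2At s δ M hM.le ε η a

/-- `ScriCompleteNearKerr`: "weak cosmic censorship is stable near sub-extremal Kerr" — every MGHD of
an `ε`-close b-conormal datum has sojourn-complete far `𝓘⁺`. [cite: Hintz2026, Thm. 13.1 (4) (p. 319)] -/
def ScriCompleteNearKerr : Prop :=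
  ∀ [Kerr.Facts] [Kerr.SliceFacts], ∀ a₁ : ℝ, a₁ < 1 → ∃ (s : ℕ) (δ : ℝ),
    ∀ (M : ℝ) (hM : 0 < M), ∃ ε > (0 : ℝ), ∀ a : ℝ, |a| ≤ a₁ * M → ScriFarAt s δ M hM.le ε a

/-- **Glue of the clause split**: `OrbitalAsymptoticC2 → ScriCompleteNearKerr → BulkKerrCaptureC2`.
[folklore] -/
theorem bulkKerrCaptureC2_of_clauseSplit (hA : OrbitalAsymptoticC2) (hB : ScriCompleteNearKerr) :
    BulkKerrCaptureC2 := by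
  rw [bulkKerrCaptureC2_iff_captureC2At]
  intro _ _ a₁ ha₁
  obtain ⟨s₁, δ₁, h₁⟩ := hA a₁ ha₁
  obtain ⟨s₂, δ₂, h₂⟩ := hB a₁ ha₁
  refine ⟨max s₁ s₂, max δ₁ δ₂, fun M hM η hη ↦ ?_⟩
  obtain ⟨ε₁, hε₁, h₁'⟩ := h₁ M hM η hη
  obtain ⟨ε₂, hε₂, h₂'⟩ := h₂ M hM
  refine ⟨min ε₁ ε₂, lt_min hε₁ hε₂, fun a ha ↦ ?_⟩
  intro D _ hvac hcon hdist 𝒟 hmax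
  have hA' : OrbitalC2At (max s₁ s₂) (max δ₁ δ₂) M hM.le (min ε₁ ε₂) η a :=
    (h₁' a ha).mono (le_max_left _ _) (le_max_left _ _) (min_le_left ε₁ ε₂) le_rfl
  have hB' : ScriFarAt (max s₁ s₂) (max δ₁ δ₂) M hM.le (min ε₁ ε₂) a :=
    (h₂' a ha).mono (le_max_right _ _) (le_max_right _ _) (min_le_right ε₁ ε₂)
  obtain ⟨M', a', 𝒟oc, hsub, hconv, hpar⟩ := hA' D hvac hcon hdist 𝒟 hmax
  exact ⟨M', a', 𝒟oc, hsub, @hB' D _ hvac hcon hdist 𝒟 hmax, hconv, hpar⟩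

/-- Converse: the crux implies both clause pieces (exact split; for the `𝓘⁺` piece take `η := 1`).
[folklore] -/
theorem clauseSplit_of_bulkKerrCaptureC2 (h : BulkKerrCaptureC2) :
    OrbitalAsymptoticC2 ∧ ScriCompleteNearKerr := by
  rw [bulkKerrCaptureC2_iff_captureC2At] at h
  refine ⟨fun {_ _} a₁ ha₁ ↦ ?_, fun {_ _} a₁ ha₁ ↦ ?_⟩
  · obtain ⟨s, δ, hsδ⟩ := h a₁ ha₁
    refine ⟨s, δ, fun M hM η hη ↦ ?_⟩
    obtain ⟨ε, hε, hcap⟩ := hsδ M hM η hη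
    refine ⟨ε, hε, fun a ha D _ hvac hcon hdist 𝒟 hmax ↦ ?_⟩
    obtain ⟨M', a', 𝒟oc, hsub, -, hconv, hpar⟩ := hcap a ha D hvac hcon hdist 𝒟 hmax
    exact ⟨M', a', 𝒟oc, hsub, hconv, hpar⟩
  · obtain ⟨s, δ, hsδ⟩ := h a₁ ha₁
    refine ⟨s, δ, fun M hM ↦ ?_⟩
    obtain ⟨ε, hε, hcap⟩ := hsδ M hM 1 one_pos
    refine ⟨ε, hε, fun a ha D _ hvac hcon hdist 𝒟 hmax ↦ ?_⟩
    obtain ⟨-, -, -, -, hfar, -, -⟩ := hcap a ha D hvac hcon hdist 𝒟 hmax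
    exact hfar

/-! ## §2(d) Import split (the promote-stub requests of leads a1/c4/c6/c8, typed) -/

/-- `ClaimPortC2`: the crux CONDITIONALLY on the named claim — the Lebesgue-number port. [folklore] -/
def ClaimPortC2 : Prop := HintzSubextremalClaim → BulkKerrCaptureC2

/-- `ClaimPortC2` holds outright (p99464). [folklore] -/
theorem claimPortC2_holds : ClaimPortC2 := fun h ↦ bulkKerrCaptureC2_of_allOrdersClaim' h

/-- **Glue of the import split** (modus ponens): its only open leaf is the claim by name. [folklore] -/
theorem bulkKerrCaptureC2_of_importSplit (h₁ : HintzSubextremalClaim) (h₂ : ClaimPortC2) :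
    BulkKerrCaptureC2 :=
  h₂ h₁

end Summit.FinalStateConjecture.FinalStateConjecture.Cruxes.BulkKerrCaptureC2.StrategyCensus

end
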